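import Mathlib
import Literature.MathematicalPhysics.QuantumFieldTheory.Balaban1983to89.B12Beta

/-!
# `Balaban1983to89.Beta.OneLoop` — STAGE 0 of the β sub-cell: the ONE-LOOP OBJECT of [Balaban1987RG1] as Lean
DEFINITIONS (no facts): the constrained Gaussian normalisation `Z^{(k)}(U)` (1.4), its background variation, the
finite polarization Hessian `Π⁰` (1.20) of `log Z^{(k)}`, the finite-torus second moment, and the dictionary to the
infinite-volume objects of `B12Beta` ((1.21)–(1.22))

CITATION HEADER (lean-in-tree rule 2026-08-18).  Sources: T. Bałaban, *Renormalization group approach to lattice gauge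
field theories. I*, Commun. Math. Phys. **109**, 249–301 (1987) [Balaban1987RG1] (held
`paper:balaban1987-cmp109-rg-i-small-field`; journal page = PDF page + 248); T. Bałaban, *Propagators for lattice gauge
theories in a background field*, Commun. Math. Phys. **99**, 389–434 (1985) [Balaban1985BackgroundPropagators] (journal
page = PDF page + 388).  Every formula quoted below was read from the x2 page renders, not from an OCR layer; transcript
`run/shared/lean/pub/pub-balaban/b2b-balaban-pv25/transcript-BETA0.md`, prose companion
`run/shared/lean/pub/pub-balaban/BETA/OBJECTS.md` (v2).  Locators: (1.4) p. 260, (1.5) p. 261, (1.20)–(1.22) p. 264,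
(2.4)–(2.11) pp. 266–267, (2.12)–(2.15) p. 268 of [Balaban1987RG1]; (3.155)–(3.158) pp. 427–428 of
[Balaban1985BackgroundPropagators].

HONEST FRAMING (cell rule, verbatim): discharging `BetaPertH` makes Bałaban's UV stability UNCONDITIONAL — a real
constructive-QFT result; it is NOT the continuum limit and NOT the Clay problem.  THIS MODULE ASSERTS NOTHING about the
series: it contains definitions, two hypothesis-carrier structures and elementary lemmas about them.  Value = sourced
definitions, NOT summit progress (audit cell `pub-balaban`, β sub-cell row BETA-0, unit `b2b-balaban-pv25`).

WHAT IS MODELLED, AND HOW (dictionary = OBJECTS.md §4, DIVERGENCE D-pv25.1).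
* [Balaban1987RG1] (1.4) p. 260, verbatim: "the factor Z^{(j)}(U_k) is given by the Gaussian integral normalizing the
  Gaussian measure for a fluctuation field in j-th step integration Z^{(j)}(U_k) = ∫ dB δ(Q̃B) exp[−½⟨B, Δ^{(j)}(U_k)B⟩]."
  with the quadratic form (1.5) p. 261 "⟨B,Δ^{(j)}(U_k)B⟩ = ⟨H_{1,j}(U_k)B, Δ_1(U_k)H_{1,j}(U_k)B⟩ −
  2⟨H_{1,j}(U_k)hC̃^{(2)}(Ū^j_k,B), J⟩ + G^{(2)}(B)", identified on p. 267 with "the definition (3.156) [13] with the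
  δ-function gauge fixing term replaced by the exponential one" ([13] = [Balaban1985BackgroundPropagators]).  On a finite
  torus `B` ranges over a finite-dimensional real space (𝔤-valued functions on the bonds of `T^{(k)}`, coordinates in a
  basis of 𝔤 orthonormal for the normalised trace form — (1.21) `δ^{ab}`, (5.43) p. 297) and `Q̃` is a linear surjection
  onto the 𝔤-valued functions on the bonds of `T^{(k+1)}` (p. 267: `LQ̃h = I`).  MODEL: `ConstrainedGaussian n m` = a
  pair (constraint matrix `Q : m × n`, symmetric form `Δ : n × n`); `logZ` = the closed form of
  `log ∫_{ℝⁿ} δ(Qv) e^{−½⟨v,Δv⟩} dv`, namely `((n − m)/2)·log 2π − ½·log |det [[Δ, Qᵀ],[Q, 0]]|` (bordered / KKT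
  determinant; valid when `Q` is onto and `Δ` is positive on `ker Q` — the classical Gaussian evaluation, recorded as
  proof obligation C-beta-6 in GAPS.md (kernel proof claimed by unit pv23), NOT used as a fact anywhere).  B9's reduced form (3.157)–(3.158) p. 428 ("B = CB̃ …
  e^{½⟨g,C^{(k)}(Λ)g⟩} = (Z′^{(k)}(Λ))^{−1} ∫ dB̃ exp[−½⟨B̃,C*Δ_kCB̃⟩ + ⟨B̃,C*g⟩] … (C*Δ_kC)^{−1} = C̃^{(k)}(Λ)") is `reduced` /
  `logZred`; the two normalisations differ by the Jacobian of the elimination, which depends on `Q̃`, hence on the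
  background (OBJECTS.md §5(a), GAPS G-beta-1) — the reason the bordered form is the primary definition.
* (1.20) p. 264, verbatim: "Let us denote E^{(j+1)}(g_j,B) = E^{(j+1)}(g_j, U_{j+1}(exp iB)). We define
  Π^{ab}_{j+1,μν}(g_j,x,x′) = (δ²/δB^a_μ(x)δB^b_ν(x′) E^{(j+1)})(g_j,0)."  The ONE-LOOP part (OBJECTS.md O11; the
  bookkeeping of `B12Beta.OneLoopSplit`): the same Hessian applied to `B ↦ log Z^{(k)}(U_{k+1}(exp iB))`.  MODEL: a
  `Family ι n m` = a map from external coordinates `ι → ℝ` to constrained Gaussians (BOTH `Q` and `Δ` may vary), and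
  `polarization F i j` = the second Fréchet derivative of `logZ ∘ F` at `0` on the coordinate vectors `e_i, e_j`.
* (1.21)–(1.22) p. 264: colour structure `δ^{ab}`, translation invariance, the limit `T^{(j+1)} ↗ ℤ^d` ("This limit
  exists by the localized representation (1.7)" — an ASSERTION, GAPS G-adv2-2) and `β_{j+1} = Σ_x Π_{j+1,μν}(x) x_μ x_ν`,
  `μ ≠ ν`.  MODEL: `torusKernel` reads `Π⁰_{μν}(x) := Π⁰^{a₀a₀}_{μν}(x, 0)` on the discrete torus `(ℤ/s)^d`;
  `torusSecondMoment` is the finite-volume second moment with symmetric representatives (a PROXY: (1.22) is the `ℤ^d` sum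
  of the limit kernel, typed as `B12Beta.secondMoment`); `IsInfiniteVolumeLimit` is the pointwise-limit notion; and
  `OneLoopDictionary` bundles, as HYPOTHESES, the data identifying `B12Beta.OneLoopSplit.β0 k` with the second moment of
  the limit of the one-loop torus kernels at scale `k` — nothing in it is asserted to exist.
NOT MODELLED here (displayed definitions over B5–B11 objects that the tree types only as abstract carriers; OBJECTS.md
§5(g)): the concrete operators `H_{1,k}`, `Δ_1`, `G_1` of [Balaban1985BackgroundPropagators] Sect. D, `Q̃`, `C̃^{(2)}`,
`h`, `J`, the minimiser `U_{k+1}(V)` of [Balaban1985VariationalBackground] Thm 1 (tree `B11Thm1`).  Rows an1/an2/num of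
the sub-cell supply concrete `Family`s; row an2's matrix calculus (`δ² log det`) targets `logZred` / `logZ`.
REVISIONS: v1 (definitions); v1.1 (docstring ids); v1.2 (referee objection G-beta-7, HOME/BETA/REFEREE-BETA.md R13–R15):
`OneLoopDictionary` gains the hypothesis fields `regular` (eventual regularity near `B = 0`) and `smooth`
(`ContDiffAt ℝ 2 (logZ) 0`, so the polarization is a genuine Hessian, not a junk value) and the COORDINATE CONVENTION
paragraph (tr-orthonormal generators for the normalised trace, B9 p. 392 / B12 p. 289 verbatim) on `model`.
-/

namespace Literature.MathematicalPhysics.QuantumFieldTheory.Balaban1983to89.Beta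

open Literature.MathematicalPhysics.QuantumFieldTheory.Balaban1983to89
open scoped Matrix

/-! ## Part 1 — the constrained Gaussian normalisation `Z^{(k)}(U)` of (1.4) -/

/-- Finite-dimensional model of the datum of [Balaban1987RG1] (1.4) p. 260 / p. 267: `n` real fluctuation coordinates
(`B′` on the bonds of `T^{(k)}`, components in a tr-orthonormal basis of 𝔤), `m` real constraint coordinates (`Q̃B′` on
the bonds of `T^{(k+1)}`); `Q` = the linearised averaging `Q̃` of (2.4) p. 266, `Δ` = the fluctuation form `Δ^{(k)}(U)`
of (1.5) p. 261 = −2 × (2.11) p. 267.  Pure data; no side condition is built in (see `Regular`).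
[cite: Balaban1987RG1, (1.4) p.260] -/
structure ConstrainedGaussian (n m : ℕ) where
  /-- the constraint `Q̃` (an `m × n` real matrix). -/
  Q : Matrix (Fin m) (Fin n) ℝ
  /-- the quadratic form `Δ^{(k)}(U)` (an `n × n` real matrix, meant symmetric). -/
  Δ : Matrix (Fin n) (Fin n) ℝ

namespace ConstrainedGaussian

variable {n m : ℕ}

/-- The side conditions under which (1.4) is a convergent Gaussian integral on `ker Q̃`: `Q̃` onto ([Balaban1987RG1]
p. 267 "LQ̃h = I"), `Δ` symmetric, and `Δ` positive definite on `ker Q̃` ([Balaban1985BackgroundPropagators] p. 428: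
"a positive definite operator C*Δ_kC with a lower bound γ_0 > 0 independent of k and U. We have proved it in [4],
Lemma 2.4, for operators with U = 1" — the general-`U` clause is an assertion, GAPS G-B9-09).  A PREDICATE (notion),
asserted of nothing. [cite: Balaban1985BackgroundPropagators, (3.158) p.428] -/
structure Regular (Z : ConstrainedGaussian n m) : Prop where
  onto : Function.Surjective Z.Q.mulVec
  symm : Z.Δ.IsSymm
  posKer : ∀ v : Fin n → ℝ, v ≠ 0 → Z.Q.mulVec v = 0 → 0 < v ⬝ᵥ Z.Δ.mulVec v

/-- The bordered (KKT) matrix `[[Δ, Qᵀ], [Q, 0]]` of the constrained quadratic form. [folklore] -/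
def kkt (Z : ConstrainedGaussian n m) : Matrix (Fin n ⊕ Fin m) (Fin n ⊕ Fin m) ℝ :=
  Matrix.fromBlocks Z.Δ Z.Qᵀ Z.Q 0

/-- The bordered matrix is symmetric when `Δ` is. [folklore] -/
theorem kkt_isSymm (Z : ConstrainedGaussian n m) (h : Z.Δ.IsSymm) : Z.kkt.IsSymm :=
  Matrix.IsSymm.fromBlocks h (Matrix.transpose_transpose _) Matrix.isSymm_zero

/-- `log Z^{(k)}(U)` in closed form: for `Q` onto and `Δ` positive on `ker Q`,
`∫_{ℝⁿ} δ(Qv) exp(−½⟨v,Δv⟩) dv = (2π)^{(n−m)/2} · |det [[Δ,Qᵀ],[Q,0]]|^{−1/2}` (δ = the `m`-dimensional Dirac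
distribution composed with the surjection `Q`; classical, proof obligation GAPS C-beta-6 — not used as a fact).  This is
the DEFINITION of the model's `log Z`; outside the `Regular` regime it is a junk value.  It keeps the Jacobian of the
constraint elimination, which in [Balaban1987RG1] depends on the background through `Q̃` (OBJECTS.md §5(a)).
[cite: Balaban1987RG1, (1.4) p.260] -/
noncomputable def logZ (Z : ConstrainedGaussian n m) : ℝ :=
  ((n : ℝ) - m) / 2 * Real.log (2 * Real.pi) - (1 / 2 : ℝ) * Real.log |Z.kkt.det|

/-- [Balaban1985BackgroundPropagators] (3.157) p. 428: after eliminating the constrained variables, "B = CB̃, where C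
is a linear operator", the form becomes `⟨B̃, C*Δ_kCB̃⟩`.  Model: for any `n × r` matrix `C` (meant: a basis of
`ker Q`), the reduced `r × r` form `CᵀΔC`. [cite: Balaban1985BackgroundPropagators, (3.157) p.428] -/
def reduced (Z : ConstrainedGaussian n m) {r : ℕ} (C : Matrix (Fin n) (Fin r) ℝ) : Matrix (Fin r) (Fin r) ℝ :=
  C.transpose * Z.Δ * C

/-- The reduced form `CᵀΔC` is symmetric when `Δ` is. [folklore] -/
theorem reduced_isSymm (Z : ConstrainedGaussian n m) {r : ℕ} (C : Matrix (Fin n) (Fin r) ℝ) (h : Z.Δ.IsSymm) :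
    (Z.reduced C).IsSymm := by
  unfold reduced Matrix.IsSymm
  rw [Matrix.transpose_mul, Matrix.transpose_mul, Matrix.transpose_transpose, h.eq, Matrix.mul_assoc]

/-- B9's normalisation `Z′^{(k)}` of (3.157) p. 428 in closed form: `log ∫_{ℝ^r} exp(−½⟨w, CᵀΔC w⟩) dw =
(r/2)·log 2π − ½·log det(CᵀΔC)` (for `CᵀΔC` positive definite).  Differs from `logZ` by the Jacobian of
`w ↦ Cw` relative to `δ(Q·)`, a function of `(Q, C)` — constant in the background ONLY if `Q̃` is (GAPS G-beta-1).
[cite: Balaban1985BackgroundPropagators, (3.157) p.428] -/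
noncomputable def logZred (Z : ConstrainedGaussian n m) {r : ℕ} (C : Matrix (Fin n) (Fin r) ℝ) : ℝ :=
  (r : ℝ) / 2 * Real.log (2 * Real.pi) - (1 / 2 : ℝ) * Real.log (Z.reduced C).det

end ConstrainedGaussian

/-! ## Part 2 — background families and the one-loop polarization Hessian (1.20) -/

/-- A background family: external coordinates `B : ι → ℝ` (for [Balaban1987RG1] (1.20): `B` a 𝔤-valued function on the
bonds of the unit lattice `T_1^{(k+1)}`, `ι` = (bond, colour) in a tr-orthonormal basis) ↦ the constrained Gaussian
datum `(Q̃, Δ^{(k)})` at the background `U_{k+1}(exp iB)` ((2.3) p. 265: `V^{(k)} = M^k(U_{k+1})`; BOTH entries may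
depend on `B`). [cite: Balaban1987RG1, (1.20) p.264] -/
abbrev Family (ι : Type*) (n m : ℕ) : Type _ := (ι → ℝ) → ConstrainedGaussian n m

namespace Family

variable {ι : Type*} {n m : ℕ}

/-- `B ↦ log Z^{(k)}(U_{k+1}(exp iB))` of the model ((1.20) p. 264 applied to the `log Z^{(k)}` term of (2.12) p. 268).
[cite: Balaban1987RG1, (2.12) p.268] -/
noncomputable def logZ (F : Family ι n m) : (ι → ℝ) → ℝ := fun B => (F B).logZ

/-- B9-normalised variant along a FIXED elimination matrix `C` (an2's parametrisation).
[cite: Balaban1985BackgroundPropagators, (3.157) p.428] -/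
noncomputable def logZred (F : Family ι n m) {r : ℕ} (C : Matrix (Fin n) (Fin r) ℝ) : (ι → ℝ) → ℝ :=
  fun B => (F B).logZred C

end Family

/-- THE ONE-LOOP POLARIZATION on a finite volume: [Balaban1987RG1] (1.20) p. 264 "Π^{ab}_{j+1,μν}(g_j,x,x′) =
(δ²/δB^a_μ(x)δB^b_ν(x′) E^{(j+1)})(g_j,0)" applied to the coupling-free part `log Z^{(k)}` of the merged `E^{(k+1)}` of
(1.6) (OBJECTS.md O11): the second Fréchet derivative of `logZ ∘ F` at `B = 0` evaluated on the coordinate vectors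
`e_i, e_j`.  (`iteratedFDeriv_two_apply`: equals `fderiv (fderiv (F.logZ)) 0 e_i e_j`; a junk value where `F.logZ` is
not twice differentiable.) [cite: Balaban1987RG1, (1.20) p.264] -/
noncomputable def polarization {ι : Type*} [Fintype ι] [DecidableEq ι] {n m : ℕ} (F : Family ι n m) (i j : ι) : ℝ :=
  iteratedFDeriv ℝ 2 F.logZ 0 ![Pi.single i 1, Pi.single j 1]

/-- The same Hessian for an arbitrary scalar function of the external field (used for the B9-normalised variant and
for the full merged `E^{(k+1)}` should a row type it): (1.20) p. 264 as an operation on functions. [cite: Balaban1987RG1, (1.20) p.264] -/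
noncomputable def hessianAt {ι : Type*} [Fintype ι] [DecidableEq ι] (f : (ι → ℝ) → ℝ) (i j : ι) : ℝ :=
  iteratedFDeriv ℝ 2 f 0 ![Pi.single i 1, Pi.single j 1]

/-- `polarization F = hessianAt F.logZ` (definitional). [folklore] -/
theorem polarization_eq_hessianAt {ι : Type*} [Fintype ι] [DecidableEq ι] {n m : ℕ} (F : Family ι n m) (i j : ι) :
    polarization F i j = hessianAt F.logZ i j := rfl

/-! ## Part 3 — torus bookkeeping: (1.21) reduction and the finite-volume second moment of (1.22) -/

/-- Sites of the discrete torus `(ℤ/s)^d` (the unit lattice `T_1^{(k+1)}` of [Balaban1987RG1] (0.1) p. 251 with all periods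
equal to `s`). [cite: Balaban1987RG1, (0.1) p.251] -/
abbrev Site (d s : ℕ) : Type := Fin d → ZMod s

/-- External coordinate index `((x, μ), a)`: bond `⟨x, x + e_μ⟩` ((5.5) p. 292: "Π_{μν}(x,y) = Π(⟨x,x+e_μ⟩,⟨y,y+e_ν⟩)")
and colour index `a` of `B^a_μ(x)` ((1.20) p. 264). [cite: Balaban1987RG1, (5.5) p.292] -/
abbrev ExtIndex (d s c : ℕ) : Type := (Site d s × Fin d) × Fin c

/-- (1.21) p. 264 read on the torus: "Π^{ab}_{j+1,μν}(g_j,x,x′) = δ^{ab}Π_{j+1,μν}(g_j, x − x′)" — the scalar kernel is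
read off at a fixed colour `a₀` and `x′ = 0`: `Π⁰_{μν}(x) := Π⁰^{a₀a₀}_{μν}(x, 0)`.  (That the Hessian HAS the form
`δ^{ab}Π(x − x′)` is a property of a concrete family — global gauge covariance and translation invariance — to be
verified by the row that builds it, OBJECTS.md §5(b); nothing is asserted here.) [cite: Balaban1987RG1, (1.21) p.264] -/
noncomputable def torusKernel {d s c n m : ℕ} [NeZero s] (F : Family (ExtIndex d s c) n m) (a₀ : Fin c) :
    Fin d → Fin d → Site d s → ℝ :=
  fun μ ν x => polarization F ((x, μ), a₀) ((0, ν), a₀)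

/-- Symmetric representative of a residue class: the integer in `]−s/2, s/2]` (for odd `s`, as in [Balaban1987RG1]
p. 251 "L is an odd positive integer", the window `[−(s−1)/2, (s−1)/2]`). [folklore] -/
def symmRep (s : ℕ) [NeZero s] (z : ZMod s) : ℤ :=
  if 2 * z.val ≤ s then (z.val : ℤ) else (z.val : ℤ) - s

example : symmRep 5 (2 : ZMod 5) = 2 := by decide
example : symmRep 5 (3 : ZMod 5) = -2 := by decide
example : symmRep 5 (4 : ZMod 5) = -1 := by decide

/-- Finite-volume second moment `Σ_{x ∈ T} Π_{μν}(x) x_μ x_ν` with symmetric representatives — the torus PROXY for the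
right member of (1.22) p. 264 / (5.42) p. 297 (which is the `ℤ^d`-sum of the infinite-volume kernel,
`B12Beta.secondMoment`; the two agree in the limit only under volume-uniform decay of the type (5.10) p. 292 —
OBJECTS.md §5(d), GAPS G-beta-4). [cite: Balaban1987RG1, (1.22) p.264] -/
noncomputable def torusSecondMoment {d s : ℕ} [NeZero s] (P : Fin d → Fin d → Site d s → ℝ) (μ ν : Fin d) : ℝ :=
  ∑ x : Site d s, P μ ν x * (symmRep s (x μ) : ℝ) * (symmRep s (x ν) : ℝ)

/-- The finite-volume one-loop coefficient of a torus family at colour `a₀` and pair `(μ, ν)`: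
`β⁰_T := Σ_{x∈T} Π⁰_{μν}(x) x_μ x_ν` (row num's observable, OBJECTS.md §6). [cite: Balaban1987RG1, (1.22) p.264] -/
noncomputable def torusBetaZero {d s c n m : ℕ} [NeZero s] (F : Family (ExtIndex d s c) n m) (a₀ : Fin c)
    (μ ν : Fin d) : ℝ :=
  torusSecondMoment (torusKernel F a₀) μ ν

/-- The infinite-volume limit notion of (1.21) p. 264 ("Now we take a limit of these functions as T^{(j+1)} ↗ Z^d"):
along a sequence of torus sides `side t` (meant strictly increasing), the torus kernels converge pointwise to a kernel on
`ℤ^d` (`B12Beta.Kernel d`).  A PREDICATE; the existence of the limit is asserted in print and not proved there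
(GAPS G-adv2-2). [cite: Balaban1987RG1, (1.21) p.264] -/
def IsInfiniteVolumeLimit {d : ℕ} (side : ℕ → ℕ) [∀ t, NeZero (side t)]
    (P : (t : ℕ) → Fin d → Fin d → Site d (side t) → ℝ) (Pinf : B12Beta.Kernel d) : Prop :=
  ∀ (μ ν : Fin d) (x : Fin d → ℤ),
    Filter.Tendsto (fun t => P t μ ν (fun i => (x i : ZMod (side t)))) Filter.atTop (nhds (Pinf μ ν x))

/-- DICTIONARY CARRIER for the β sub-cell (hypotheses, nothing asserted; OBJECTS.md §4): the data that identify the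
abstract one-loop coefficients `S.β0 k` of the printed split `B12Beta.OneLoopSplit` ([Balaban1987RG1] (2.12)–(2.14)
p. 268) with Bałaban's construction — per scale `k` and volume index `t`, a torus family of constrained Gaussians
(`model k t` = `B ↦ (Q̃, Δ^{(k)})` at `U_{k+1}(exp iB)` on the torus of side `side k t`), colour-independence of the
scalar kernel ((1.21) `δ^{ab}`), the infinite-volume limit kernel `Π⁰_{k+1}` and the identification
`β0 k = Σ_x Π⁰_{k+1,μν}(x) x_μ x_ν`, `μ ≠ ν` ((1.22)).  Index pairing `Z^{(k)} ↔ β⁰_{k+1}` per (2.12) + (2.15).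
[cite: Balaban1987RG1, (2.12)–(2.15) p.268] -/
structure OneLoopDictionary (d c : ℕ) {β : (k : ℕ) → (Fin (k + 1) → ℝ) → ℝ} (S : B12Beta.OneLoopSplit β) where
  /-- torus side at scale `k`, volume index `t` (all positive; meant `↗ ∞` in `t`). -/
  side : ℕ → ℕ → ℕ
  side_pos : ∀ k t, 0 < side k t
  /-- numbers of fluctuation and constraint coordinates. -/
  nFl : ℕ → ℕ → ℕ
  mCo : ℕ → ℕ → ℕ
  /-- the one-loop torus model at scale `k`, volume `t`.  COORDINATE CONVENTION (binding on every instance; not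
  machine-checkable at this level of abstraction — GAPS G-beta-3, referee G-beta-7): the background coordinate indexed by
  `((x, μ), a) : ExtIndex d s c` is the component `B^a_μ(x)` of `B_μ(x) = Σ_a B^a_μ(x) τ_a` for generators `τ_a` that are
  ORTHONORMAL FOR BAŁABAN'S NORMALISED TRACE — B9 p. 392: "by X·Y = tr XY. Let us recall that the trace is normalized,
  i.e., tr 1 = 1."; B12 p. 289: "An element **E** in **g**⊗**g** can be identified with the matrix **E**_{ab} of components
  in the basis {τ_a⊗τ_b}, τ_a are generators of the algebra **g**, … **E**_{ab} = **E**δ_{ab}, and then ⟨**E**, A⊗B⟩ =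
  **E** tr AB." (the last equality forces tr τ_aτ_b = δ_{ab}).  With physics generators (Tr T_aT_b = ½δ_{ab}) the same
  recipe returns `β⁰/2N` (unit record: `B12Normalization`, HOME/BETA/OBJECTS.md §3). -/
  model : (k t : ℕ) → Family (ExtIndex d (side k t) c) (nFl k t) (mCo k t)
  /-- REGULARITY near the zero background (referee objection G-beta-7, v1.2): eventually in `B → 0` the model is a regular
  constrained Gaussian (`Q` onto, `Δ` symmetric and positive on `ker Q`), so that `logZ` is the logarithm of an actual
  Gaussian integral there (identity: GAPS C-beta-6, kernels by other seats). -/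
  regular : ∀ k t, ∀ᶠ B in nhds (0 : ExtIndex d (side k t) c → ℝ), (model k t B).Regular
  /-- REGULARITY (G-beta-7, v1.2): `B ↦ log Z^{(k)}_T(B)` is `C²` at `B = 0`, so that `polarization` / `torusKernel` are
  genuine second derivatives — without this clause `iteratedFDeriv ℝ 2 _ 0` is a junk value and `beta0_eq` would be
  vacuous bookkeeping. -/
  smooth : ∀ k t, haveI : NeZero (side k t) := ⟨(side_pos k t).ne'⟩; ContDiffAt ℝ 2 (Family.logZ (model k t)) 0
  /-- the scalar torus kernels `Π⁰_{k+1,μν}` (read at colour `a`) do not depend on the colour ((1.21) `δ^{ab}`). -/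
  colourFree : ∀ k t (a b : Fin c),
    @torusKernel d (side k t) c _ _ ⟨(side_pos k t).ne'⟩ (model k t) a =
      @torusKernel d (side k t) c _ _ ⟨(side_pos k t).ne'⟩ (model k t) b
  /-- the infinite-volume one-loop kernel `Π⁰_{k+1}` on `ℤ^d`. -/
  limKernel : ℕ → B12Beta.Kernel d
  /-- (1.21): the torus kernels converge to it. -/
  isLimit : ∀ k (a : Fin c),
    @IsInfiniteVolumeLimit d (side k) (fun t => ⟨(side_pos k t).ne'⟩)
      (fun t => @torusKernel d (side k t) c _ _ ⟨(side_pos k t).ne'⟩ (model k t) a) (limKernel k)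
  /-- (1.22) for the one-loop part: `β⁰_{k+1} = Σ_x Π⁰_{k+1,μν}(x) x_μ x_ν` for every pair `μ ≠ ν`. -/
  beta0_eq : ∀ k (μ ν : Fin d), μ ≠ ν → S.β0 k = B12Beta.secondMoment (limKernel k) μ ν

end Literature.MathematicalPhysics.QuantumFieldTheory.Balaban1983to89.Beta
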